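import Summits.Ventures.CertifiedManyBodySolver.Downfold.EmeryFermiScaleHarmonic
import HarnessLib

/-!
# THE t′-HARMONIC LAW OF THE Cu WEIGHT: on every contour of the σ three-band model the Cu-d weight of the Bloch state is a MÖBIUS function of the harmonic
# `s(k) = (1 − cos k_x cos k_y)/2`, `w_d(k; ε) = 2t_pd²E·(2E·fsT + g·cA + 8g·fsN·s)/(fsN1·(α + 8β·s))`, and its determinant FACTORISES:
# `g·fsN·α − β·(2E·fsT + g·cA) = 2g·E·(t_pd² + t_ppε)·(2t_pd² + (t_pp − t_pp′)ε)·fsT` — the Cu character GROWS monotonically with `s` along every Fermi surface, certificate-free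

Venture CertifiedManyBodySolver, cell `pub/hubbard-downfold` (stage S1; INFLATION-RULES-3to1-B §B.73 (the weight levers) and §B.75 (the harmonic law)), seat hubbard-downfold-mod-4 (technique B,
g30); namespace `Summit.Ventures.CertifiedManyBodySolver.Downfold.Emery`. Sequel of `EmeryOrbitalWeight` (`minorD`, `dWeight = minorD/∂_ε charCubic`), `EmeryOrbitalWeightCheck`/`…Node`
(`fsN1 = 4t_pd² + 2ε(t_pp − t_pp′)`) and `EmeryFermiScaleHarmonic` (`scaleAlpha`, `scaleBeta`, `tpHarm`, `fsT·∂_ε charCubic = α + 8β·s` on a contour). Everything PROVED (0 sorry;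
`ring` identities + sign bookkeeping — no certificate). WHAT THIS IS NOT: a statement about any material; `U = 0` one-body kinematics of the σ model as printed; not a correlated
spectral-weight statement.

* §1 IDENTITIES: `fsN1_mul_minorD`: `fsN1·minorD(x, y) = 4t_pd²E(E + 2g(x + y)) + 2(t_pp − t_pp′)·charCubic(x, y)` (every `x, y, ε`; `E = Δ + ε`, `g = t_pp + t_pp′`);
  `cA_add_harm`: `cA + 8fsN·s(x, y) = charCubic(x, y) + 4fsT·(x + y)` (the contour fixes `x + y` AFFINELY in `s`). Hence ON A CONTOUR (`dWeight_eq_harmonic`):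
  **`w_d(k; ε) = weightHarmN(s)/(fsN1·(α + 8β·s))`**, `weightHarmN(s) = 2t_pd²E·(2E·fsT + g·cA + 8g·fsN·s)` — a Möbius function of the harmonic with closed-form energy-dependent
  coefficients, of which g29's `dWeightNode_eq` / `dWeightFace_eq` / `dWeightAxis_eq` are the instances `s = 2x_N(1 − x_N)`, `1 − yFace`, `x_A`.
* §2 THE DETERMINANT FACTORISES (`weightDet_eq`, `ring`): `g·fsN·α − β·(2E·fsT + g·cA) = 2g·E·(t_pd² + t_ppε)·(2t_pd² + (t_pp − t_pp′)ε)·fsT`; two-point form `weight_cross_eq`.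
* §3 **`dWeight_mono_tpHarm`**: in the regime `Δ + ε > 0`, `ε ≥ 0`, `0 ≤ t_pp′ ≤ t_pp`, `t_pp′ε < t_pd²`, `t_pd ≠ 0`, two points of ONE contour with `s(k₁) ≤ s(k₂)` and positive energy
  denominators satisfy `w_d(k₁) ≤ w_d(k₂)` — the Cu character of the Fermi-surface states increases monotonically with `(1 − cos k_x cos k_y)/2`, for EVERY σ set and filling
  (no `t_ppΔ` condition, no sign of `β`): the exact law behind the universal window `[w_node, w_axis]` of `EmeryOrbitalWeightAxis`.

Sources: three-band model [HybertsenSchluterChristensen1989, Eq. (1)]; bilinear contour and `t, t′` language [AndersenEtAl1995, §6]; [folklore] algebra.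
-/

noncomputable section

namespace Summit.Ventures.CertifiedManyBodySolver.Downfold.Emery

open Real Set

/-! ## §1 The Möbius law -/

/-- `fsN1·minorD = 4t_pd²E(E + 2g(x + y)) + 2(t_pp − t_pp′)·charCubic` for every `x, y, ε`. [folklore] -/
theorem fsN1_mul_minorD (Δ tpd tpp c x y ε : ℝ) :
    fsN1 tpd tpp c ε * minorD Δ tpp c x y ε =
      4 * tpd ^ 2 * (Δ + ε) * ((Δ + ε) + 2 * (tpp + c) * (x + y)) + 2 * (tpp - c) * charCubic Δ tpd tpp c x y ε := by
  unfold fsN1 minorD charCubic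
  ring

/-- `cA + 8fsN·s(x, y) = charCubic(x, y) + 4fsT·(x + y)`: on a contour the sum `x + y` is affine in the harmonic `s`. [folklore] -/
theorem cA_add_harm (Δ tpd tpp c x y ε : ℝ) :
    cA Δ ε + 8 * fsN tpd tpp c ε * tpHarm x y = charCubic Δ tpd tpp c x y ε + 4 * fsT Δ tpd tpp c ε * (x + y) := by
  rw [charCubic_bilinear]
  unfold tpHarm fsT
  ring

/-- Numerator of the Möbius law: `weightHarmN(s) = 2t_pd²E·(2E·fsT + g·cA + 8g·fsN·s)`. [folklore] -/
def weightHarmN (Δ tpd tpp c ε s : ℝ) : ℝ :=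
  2 * tpd ^ 2 * (Δ + ε) * (2 * (Δ + ε) * fsT Δ tpd tpp c ε + (tpp + c) * cA Δ ε + 8 * (tpp + c) * fsN tpd tpp c ε * s)

/-- **THE t′-HARMONIC LAW OF THE Cu WEIGHT**: at a contour point with non-zero `fsT`, `fsN1` and energy denominator, `w_d(k; ε) = weightHarmN(s(k))/(fsN1·(α + 8β·s(k)))`. [folklore] -/
theorem dWeight_eq_harmonic {Δ tpd tpp c x y ε : ℝ} (hP : charCubic Δ tpd tpp c x y ε = 0) (hT : fsT Δ tpd tpp c ε ≠ 0) (hN1 : fsN1 tpd tpp c ε ≠ 0)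
    (hW : dcharCubic Δ tpd tpp c x y ε ≠ 0) :
    dWeight Δ tpd tpp c x y ε = weightHarmN Δ tpd tpp c ε (tpHarm x y) / (fsN1 tpd tpp c ε * (scaleAlpha Δ tpd tpp c ε + 8 * scaleBeta Δ tpd tpp c ε * tpHarm x y)) := by
  have h1 := fsN1_mul_minorD Δ tpd tpp c x y ε
  rw [hP, mul_zero, add_zero] at h1
  have h2 := cA_add_harm Δ tpd tpp c x y ε
  rw [hP, zero_add] at h2
  have h3 := fsT_mul_dcharCubic_of_contour hP
  have hden : scaleAlpha Δ tpd tpp c ε + 8 * scaleBeta Δ tpd tpp c ε * tpHarm x y ≠ 0 := by rw [← h3]; exact mul_ne_zero hT hW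
  rw [dWeight_eq_div_dcharCubic, div_eq_div_iff hW (mul_ne_zero hN1 hden)]
  unfold weightHarmN
  linear_combination (scaleAlpha Δ tpd tpp c ε + 8 * scaleBeta Δ tpd tpp c ε * tpHarm x y) * h1
    - (4 * tpd ^ 2 * (Δ + ε) * ((Δ + ε) + 2 * (tpp + c) * (x + y))) * h3
    - (2 * tpd ^ 2 * (Δ + ε) * (tpp + c) * dcharCubic Δ tpd tpp c x y ε) * h2

/-! ## §2 The determinant factorises -/

/-- **THE WEIGHT DETERMINANT**: `g·fsN·α − β·(2E·fsT + g·cA) = 2g·E·(t_pd² + t_ppε)·(2t_pd² + (t_pp − t_pp′)ε)·fsT` (`ring`). [folklore] -/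
theorem weightDet_eq (Δ tpd tpp c ε : ℝ) :
    (tpp + c) * fsN tpd tpp c ε * scaleAlpha Δ tpd tpp c ε - scaleBeta Δ tpd tpp c ε * (2 * (Δ + ε) * fsT Δ tpd tpp c ε + (tpp + c) * cA Δ ε) =
      2 * (tpp + c) * (Δ + ε) * (tpd ^ 2 + tpp * ε) * (2 * tpd ^ 2 + (tpp - c) * ε) * fsT Δ tpd tpp c ε := by
  unfold scaleAlpha scaleBeta dfsT fsT fsD fsN cA dcA dfsD dfsN
  ring

/-- TWO-POINT FORM: `weightHarmN(s₂)·(α + 8βs₁) − weightHarmN(s₁)·(α + 8βs₂) = 32t_pd²E²·g·(t_pd² + t_ppε)·(2t_pd² + (t_pp − t_pp′)ε)·fsT·(s₂ − s₁)`. [folklore] -/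
theorem weight_cross_eq (Δ tpd tpp c ε s₁ s₂ : ℝ) :
    weightHarmN Δ tpd tpp c ε s₂ * (scaleAlpha Δ tpd tpp c ε + 8 * scaleBeta Δ tpd tpp c ε * s₁)
      - weightHarmN Δ tpd tpp c ε s₁ * (scaleAlpha Δ tpd tpp c ε + 8 * scaleBeta Δ tpd tpp c ε * s₂) =
      32 * tpd ^ 2 * (Δ + ε) ^ 2 * (tpp + c) * (tpd ^ 2 + tpp * ε) * (2 * tpd ^ 2 + (tpp - c) * ε) * fsT Δ tpd tpp c ε * (s₂ - s₁) := by
  unfold weightHarmN scaleAlpha scaleBeta dfsT fsT fsD fsN cA dcA dfsD dfsN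
  ring

/-! ## §3 The Cu weight grows with the harmonic along every contour -/

/-- **`dWeight` IS NON-DECREASING IN THE HARMONIC ALONG EVERY CONTOUR**: `Δ + ε > 0`, `ε ≥ 0`, `0 ≤ t_pp′ ≤ t_pp`, `t_pp′ε < t_pd²`, `t_pd ≠ 0`, two contour points with positive energy
denominators and `s(k₁) ≤ s(k₂)` ⇒ `w_d(k₁; ε) ≤ w_d(k₂; ε)` — no condition on `t_ppΔ`, no sign of `β`. [folklore] -/
theorem dWeight_mono_tpHarm {Δ tpd tpp c x₁ y₁ x₂ y₂ ε : ℝ} (hE : 0 < Δ + ε) (hε : 0 ≤ ε) (hc : 0 ≤ c) (hct : c ≤ tpp) (htpd : tpd ≠ 0) (hm : c * ε < tpd ^ 2)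
    (hP₁ : charCubic Δ tpd tpp c x₁ y₁ ε = 0) (hP₂ : charCubic Δ tpd tpp c x₂ y₂ ε = 0) (hW₁ : 0 < dcharCubic Δ tpd tpp c x₁ y₁ ε) (hW₂ : 0 < dcharCubic Δ tpd tpp c x₂ y₂ ε)
    (hs : tpHarm x₁ y₁ ≤ tpHarm x₂ y₂) :
    dWeight Δ tpd tpp c x₁ y₁ ε ≤ dWeight Δ tpd tpp c x₂ y₂ ε := by
  have ht : 0 < tpd ^ 2 := by positivity
  have hD : 0 < fsD Δ tpd c ε := fsD_pos hE hm
  have hN : 0 ≤ fsN tpd tpp c ε := fsN_nonneg (tpd := tpd) hc hct hε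
  have hT : 0 < fsT Δ tpd tpp c ε := by unfold fsT; positivity
  have hN1 : 0 < fsN1 tpd tpp c ε := fsN1_pos hct hε htpd
  have e1 := fsT_mul_dcharCubic_of_contour hP₁
  have e2 := fsT_mul_dcharCubic_of_contour hP₂
  have hd1 : 0 < scaleAlpha Δ tpd tpp c ε + 8 * scaleBeta Δ tpd tpp c ε * tpHarm x₁ y₁ := by rw [← e1]; exact mul_pos hT hW₁
  have hd2 : 0 < scaleAlpha Δ tpd tpp c ε + 8 * scaleBeta Δ tpd tpp c ε * tpHarm x₂ y₂ := by rw [← e2]; exact mul_pos hT hW₂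
  rw [dWeight_eq_harmonic hP₁ hT.ne' hN1.ne' hW₁.ne', dWeight_eq_harmonic hP₂ hT.ne' hN1.ne' hW₂.ne',
    div_le_div_iff₀ (mul_pos hN1 hd1) (mul_pos hN1 hd2), ← sub_nonneg]
  have key := weight_cross_eq Δ tpd tpp c ε (tpHarm x₁ y₁) (tpHarm x₂ y₂)
  have hg : 0 ≤ tpp + c := by linarith
  have hb : 0 ≤ tpd ^ 2 + tpp * ε := by nlinarith
  have hν : 0 < 2 * tpd ^ 2 + (tpp - c) * ε := by nlinarith [mul_nonneg (sub_nonneg.2 hct) hε]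
  have hrhs : 0 ≤ 32 * tpd ^ 2 * (Δ + ε) ^ 2 * (tpp + c) * (tpd ^ 2 + tpp * ε) * (2 * tpd ^ 2 + (tpp - c) * ε) * fsT Δ tpd tpp c ε * (tpHarm x₂ y₂ - tpHarm x₁ y₁) := by
    have : 0 ≤ tpHarm x₂ y₂ - tpHarm x₁ y₁ := sub_nonneg.2 hs
    positivity
  have : weightHarmN Δ tpd tpp c ε (tpHarm x₂ y₂) * (fsN1 tpd tpp c ε * (scaleAlpha Δ tpd tpp c ε + 8 * scaleBeta Δ tpd tpp c ε * tpHarm x₁ y₁))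
      - weightHarmN Δ tpd tpp c ε (tpHarm x₁ y₁) * (fsN1 tpd tpp c ε * (scaleAlpha Δ tpd tpp c ε + 8 * scaleBeta Δ tpd tpp c ε * tpHarm x₂ y₂))
      = fsN1 tpd tpp c ε * (32 * tpd ^ 2 * (Δ + ε) ^ 2 * (tpp + c) * (tpd ^ 2 + tpp * ε) * (2 * tpd ^ 2 + (tpp - c) * ε) * fsT Δ tpd tpp c ε * (tpHarm x₂ y₂ - tpHarm x₁ y₁)) := by
    rw [← key]; ring
  rw [this]
  exact mul_nonneg hN1.le hrhs

end Summit.Ventures.CertifiedManyBodySolver.Downfold.Emery
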